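import Literature.Computability.MetaComplexity.SchemeEncBricks
import Literature.Computability.Complexity.Promise
import Literature.Computability.Complexity.UniformProbBlocks
import Literature.Computability.Complexity.CoinCounting
import Literature.Computability.Complexity.PlumbingBricks
import Literature.Computability.Complexity.LengthCompare
import Literature.Computability.Complexity.FPStringBricks
import HarnessLib

/-!
# Complexity meta: the derandomised acceptance-probability test of the proof of Thm. 8.9 (Hirahara 2021, Eq. (13))

Topic `Literature/Computability/MetaComplexity`. In the proof of Thm. 8.9 of S. Hirahara, *Average-case
hardness of NP from exponential worst-case hardness assumptions* (STOC 2021; ECCC TR21-058, p. 41),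
the checker computes "using the pseudorandom generator of Lemma 3.4" a value `v` with
`|v - Pr_{w}[M(x, w; 1^{⟨n,k',t',s⟩}) = 1]| ≤ δ` (Eq. (13)) and accepts iff `v ≤ 2δ`. What the proof
uses of this step is a deterministic polynomial-time test that accepts whenever the acceptance
probability is small and only if it is not large. This file PROVES that such a test exists from the
promise-class form of Lemma 3.4, `pr-BPP = pr-P` (the inclusion `PromiseBPP' ⊆ PromiseP` of the
textbook classes of `Promise.lean`), for any polynomial-time `M`:

* `accThreshold M` — the promise problem on instances `⟨x, 1^ι, 1^m⟩ = schemeEnc (x, ι, m)`: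
  yes iff `Pr_{w ← {0,1}^m}[(x ‖ w, 1^ι) ∈ M] ≤ 1/32`, no iff this probability is `≥ 2/3`;
* `accThreshold_mem_PromiseBPP'` — it lies in `PromiseBPP'` when `M ∈ P`: one sample `w := ` the
  first `m` coins, accept iff `(x ‖ w, 1^ι) ∉ M` (an `FP` one-bit test; fresh-coin counting);
* `exists_accTester` — hence, if `PromiseBPP' ⊆ PromiseP`, there is `T ∈ P` containing every
  `⟨x, 1^ι, 1^m⟩` of acceptance probability `≤ 1/32` and none of probability `≥ 2/3` — the fields
  `Tst, tst_complete, tst_sound` of the toolkit of `UPSearchScheme.lean`.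

(The constants `1/32 < 2/3` replace the paper's `2δ, 3δ` with `δ = 1/24`; for `UP` no random string
`r` and no Markov step are needed, so any such pair of constants works.)

## References

* S. Hirahara, *Average-case hardness of NP from exponential worst-case hardness assumptions*,
  STOC 2021; full version ECCC TR21-058: proof of Thm. 8.9, Eq. (13) (p. 41); Lemma 3.4 and its use
  as "`pr-BPP = pr-P`" (p. 27).
* O. Goldreich, *On promise problems*, 2006, Def. 1.2 (promise-BPP); S. Arora, B. Barak,
  *Computational Complexity*, CUP 2009, §7.4.1 (fresh coins).
-/

namespace Literature.Computability.MetaComplexity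

open _root_.Computability Complexity Complexity.Classes Brick Polynomial

/-! ### The threshold promise problem -/

/-- The acceptance event `{w | (x ‖ w, 1^ι) ∈ M}` of length-`m` strings (its `uniformProb m` is the
probability of Eq. (13)). [Hirahara 2021 (ECCC TR21-058), proof of Thm. 8.9, Eq. (13)]
[cite: Hirahara2021, Thm. 8.9 (proof)] -/
def accEvent (M : Set (List Bool)) (x : List Bool) (ι : ℕ) : Set (List Bool) :=
  {w | paramEnc (x ++ w, ι) ∈ M}

/-- **The threshold promise problem of Eq. (13)**: instances `⟨x, 1^ι, 1^m⟩`; yes iff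
`Pr_{w ← {0,1}^m}[(x ‖ w, 1^ι) ∈ M] ≤ 1/32`, no iff it is `≥ 2/3`. [Hirahara 2021 (ECCC TR21-058),
proof of Thm. 8.9, Eq. (13)] [cite: Hirahara2021, Thm. 8.9 (proof)] -/
def accThreshold (M : Set (List Bool)) : PromiseProblem :=
  ⟨{v | ∃ (x : List Bool) (ι m : ℕ), v = schemeEnc (x, ι, m) ∧ uniformProb m (accEvent M x ι) ≤ 1 / 32},
    {v | ∃ (x : List Bool) (ι m : ℕ), v = schemeEnc (x, ι, m) ∧ 2 / 3 ≤ uniformProb m (accEvent M x ι)}⟩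

/-- Decoding a yes-instance. [folklore] -/
theorem schemeEnc_mem_accThreshold_yes_iff (M : Set (List Bool)) (x : List Bool) (ι m : ℕ) :
    schemeEnc (x, ι, m) ∈ (accThreshold M).yes ↔ uniformProb m (accEvent M x ι) ≤ 1 / 32 := by
  constructor
  · rintro ⟨x', ι', m', h, hp⟩
    have := congr_arg decScheme h
    simp only [decScheme_schemeEnc, Prod.mk.injEq] at this
    obtain ⟨rfl, rfl, rfl⟩ := this
    exact hp
  · exact fun h => ⟨x, ι, m, rfl, h⟩

/-- Decoding a no-instance. [folklore] -/
theorem schemeEnc_mem_accThreshold_no_iff (M : Set (List Bool)) (x : List Bool) (ι m : ℕ) :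
    schemeEnc (x, ι, m) ∈ (accThreshold M).no ↔ 2 / 3 ≤ uniformProb m (accEvent M x ι) := by
  constructor
  · rintro ⟨x', ι', m', h, hp⟩
    have := congr_arg decScheme h
    simp only [decScheme_schemeEnc, Prod.mk.injEq] at this
    obtain ⟨rfl, rfl, rfl⟩ := this
    exact hp
  · exact fun h => ⟨x, ι, m, rfl, h⟩

/-! ### The one-sample test -/

section Machine

/-- The normalised instance `schemeEnc (decScheme inst)` from `⟨inst, y⟩`. [folklore] -/
noncomputable def instF : List Bool → List Bool := normScheme ∘ fstF

/-- The sample `w := y ↾ m` from `⟨⟨x, 1^ι, 1^m⟩, y⟩`. [Hirahara 2021 (ECCC TR21-058), Eq. (13)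
(one sample of `w`)] [folklore] -/
noncomputable def sampleF : List Bool → List Bool := Plumb.takeFn ∘ fanoutFn (sndPow 1 ∘ instF) sndF

/-- The query `(x ‖ w, 1^ι)`. [folklore] -/
noncomputable def queryF : List Bool → List Bool :=
  fanoutFn (fun z => (fstF ∘ instF) z ++ sampleF z) (nthF 1 ∘ instF)

variable (memTest : List Bool → List Bool)

/-- The test: accept iff the query is *not* in `M`. [Hirahara 2021 (ECCC TR21-058), Eq. (13)]
[folklore] -/
noncomputable def oneSampleF : List Bool → List Bool := notFn memTest ∘ queryF

/-- Semantics of the query on `⟨⟨x, 1^ι, 1^m⟩, y⟩`. [folklore] -/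
theorem queryF_boolPair (x y : List Bool) (ι m : ℕ) :
    queryF (boolPair (schemeEnc (x, ι, m)) y) = paramEnc (x ++ y.take m, ι) := by
  have hinst : instF (boolPair (schemeEnc (x, ι, m)) y) = schemeEnc (x, ι, m) := by
    simp [instF, normScheme_apply]
  have hlen : (unaryEncodeNat m).length = m := by
    rw [OracleCompose.unaryEncodeNat_eq_replicate, List.length_replicate]
  simp only [queryF, sampleF, fanoutFn_apply, Function.comp_apply, hinst]
  simp [schemeEnc, paramEnc, hlen]

/-- Semantics of the test on `⟨⟨x, 1^ι, 1^m⟩, y⟩`. [folklore] -/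
theorem oneSampleF_boolPair {M : Set (List Bool)} (hmem : ∀ v, memTest v = [M.boolIndicator v])
    (x y : List Bool) (ι m : ℕ) :
    oneSampleF memTest (boolPair (schemeEnc (x, ι, m)) y) = [!M.boolIndicator (paramEnc (x ++ y.take m, ι))] := by
  simp only [oneSampleF, Function.comp_apply, queryF_boolPair]
  exact notFn_apply (hmem _)

/-- `queryF ∈ FP`. [folklore] -/
theorem queryF_mem_FP : queryF ∈ FP := by
  have hi : instF ∈ FP := comp_mem_FP normScheme_mem_FP fstF_mem_FP
  have hs : sampleF ∈ FP := by
    unfold sampleF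
    exact comp_mem_FP Plumb.takeFn_mem_FP (fanoutFn_mem_FP (comp_mem_FP (sndPow_mem_FP 1) hi) sndF_mem_FP)
  unfold queryF
  exact fanoutFn_mem_FP (append_mem_FP (comp_mem_FP fstF_mem_FP hi) hs) (comp_mem_FP (nthF_mem_FP 1) hi)

/-- `oneSampleF ∈ FP` for `memTest ∈ FP`. [folklore] -/
theorem oneSampleF_mem_FP (h : memTest ∈ FP) : oneSampleF memTest ∈ FP := by
  unfold oneSampleF
  exact comp_mem_FP (notFn_mem_FP h) queryF_mem_FP

end Machine

/-! ### Counting -/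

/-- The instance is at least as long as the sample length `m`. [folklore] -/
theorem le_length_schemeEnc (x : List Bool) (ι m : ℕ) : m ≤ (schemeEnc (x, ι, m)).length := by
  have hm : (unaryEncodeNat m).length = m := by
    rw [OracleCompose.unaryEncodeNat_eq_replicate, List.length_replicate]
  simp only [schemeEnc, length_boolPair]
  omega

/-- **Fresh coins**: the first `m` of `Q ≥ m` uniform coins are uniform, so the prefix event has
probability at most that of its base. [Arora–Barak 2009, §7.4.1] [folklore] -/
theorem uniformProb_take_le {m Q : ℕ} (hQ : m ≤ Q) (E : Set (List Bool)) :
    uniformProb Q {y | y.take m ∈ E} ≤ uniformProb m E := by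
  obtain ⟨d, rfl⟩ := Nat.exists_eq_add_of_le hQ
  have h := uniformProb_block_le (a := 0) (ℓ := m) (d := d) (fun _ => E) (δ := uniformProb m E)
    (fun _ _ => le_rfl)
  simpa using h

/-- The prefix event has probability at least that of its base (complement of the previous bound).
[Arora–Barak 2009, §7.4.1] [folklore] -/
theorem le_uniformProb_take {m Q : ℕ} (hQ : m ≤ Q) (E : Set (List Bool)) :
    uniformProb m E ≤ uniformProb Q {y | y.take m ∈ E} := by
  have h1 := uniformProb_take_le hQ Eᶜ
  have hc1 : {y : List Bool | y.take m ∈ Eᶜ} = {y : List Bool | y.take m ∈ E}ᶜ := by ext y; simp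
  rw [hc1, uniformProb_compl, uniformProb_compl] at h1
  linarith

/-! ### The test is a `PromiseBPP'` witness -/

/-- **The threshold problem lies in `PromiseBPP'`** when `M ∈ P`: the probabilistic machine reads
one sample `w` (the first `m` coins) and accepts iff `(x ‖ w, 1^ι) ∉ M`; on a yes-instance it
accepts with probability `≥ 1 - 1/32 ≥ 2/3`, on a no-instance it rejects with probability `≥ 2/3`.
[Hirahara 2021 (ECCC TR21-058), proof of Thm. 8.9, Eq. (13); Goldreich 2006, Def. 1.2]
[cite: Hirahara2021, Thm. 8.9 (proof)] -/
theorem accThreshold_mem_PromiseBPP' {M : Set (List Bool)} (hM : M ∈ P) : accThreshold M ∈ PromiseBPP' := by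
  -- the membership test of `M` as a one-bit `FP` function
  obtain ⟨r, Mach, hMach⟩ := polyTimeDecidable_iff.1 (mem_P_iff_holds.1 hM)
  have hdec : (fun z : List Bool => encodeBool (M.boolIndicator z)) ∈ FP := ⟨r, Mach, fun z => hMach z⟩
  set memTest : List Bool → List Bool := fun z => encodeBool (M.boolIndicator z) with hmt
  have hmem : ∀ v, memTest v = [M.boolIndicator v] := fun v => rfl
  -- the witness language
  set L₂ : Language Bool := {z | oneSampleF memTest z = [true]} with hL₂
  have hone : OneBit (oneSampleF memTest) := (oneBit_notFn fun z => ⟨_, rfl⟩).comp _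
  have hL₂P : L₂ ∈ Classes.P := by
    refine mem_P_of_mem_FP (oneSampleF_mem_FP memTest hdec) L₂ fun w => ⟨fun hw => hw, fun hw => ?_⟩
    obtain ⟨b, hb⟩ := hone w
    cases b with
    | true => exact absurd hb hw
    | false => exact hb
  refine ⟨L₂, hL₂P, X, fun v hv => ?_, fun v hv => ?_⟩
  · -- yes-instances
    obtain ⟨x, ι, m, rfl, hp⟩ := hv
    set Q := (X : Polynomial ℕ).eval (schemeEnc (x, ι, m)).length with hQ
    have hmQ : m ≤ Q := by rw [hQ, eval_X]; exact le_length_schemeEnc x ι m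
    have hset : {y : List Bool | boolPair (schemeEnc (x, ι, m)) y ∈ L₂} = {y | y.take m ∈ accEvent M x ι}ᶜ := by
      ext y
      simp only [Set.mem_setOf_eq, Set.mem_compl_iff]
      change oneSampleF memTest (boolPair (schemeEnc (x, ι, m)) y) = [true] ↔ _
      rw [oneSampleF_boolPair memTest hmem, List.cons.injEq]
      simp only [and_true, Bool.not_eq_true', accEvent, Set.mem_setOf_eq]
      exact (Set.notMem_iff_boolIndicator _ _).symm
    rw [hset, uniformProb_compl]
    have := uniformProb_take_le hmQ (accEvent M x ι)
    linarith
  · -- no-instances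
    obtain ⟨x, ι, m, rfl, hp⟩ := hv
    set Q := (X : Polynomial ℕ).eval (schemeEnc (x, ι, m)).length with hQ
    have hmQ : m ≤ Q := by rw [hQ, eval_X]; exact le_length_schemeEnc x ι m
    have hset : {y : List Bool | boolPair (schemeEnc (x, ι, m)) y ∉ L₂} = {y | y.take m ∈ accEvent M x ι} := by
      ext y
      simp only [Set.mem_setOf_eq]
      change ¬ (oneSampleF memTest (boolPair (schemeEnc (x, ι, m)) y) = [true]) ↔ _
      rw [oneSampleF_boolPair memTest hmem, List.cons.injEq]
      simp only [and_true, Bool.not_eq_true', Bool.not_eq_false, accEvent, Set.mem_setOf_eq]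
      exact (Set.mem_iff_boolIndicator _ _).symm
    rw [hset]
    exact hp.trans (le_uniformProb_take hmQ (accEvent M x ι))

/-- **The derandomised test (Eq. (13) via `pr-BPP = pr-P`).** If `PromiseBPP' ⊆ PromiseP` and
`M ∈ P`, there is `T ∈ P` such that every `⟨x, 1^ι, 1^m⟩` with
`Pr_{w ← {0,1}^m}[(x ‖ w, 1^ι) ∈ M] ≤ 1/32` lies in `T`, and every `⟨x, 1^ι, 1^m⟩ ∈ T` has this
probability `< 2/3`. [Hirahara 2021 (ECCC TR21-058), proof of Thm. 8.9, Eq. (13) with Lemma 3.4]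
[cite: Hirahara2021, Thm. 8.9 (proof)] -/
theorem exists_accTester (hBPP : PromiseBPP' ⊆ PromiseP) {M : Set (List Bool)} (hM : M ∈ P) :
    ∃ T : Set (List Bool), T ∈ P ∧
      (∀ (x : List Bool) (ι m : ℕ), uniformProb m (accEvent M x ι) ≤ 1 / 32 → schemeEnc (x, ι, m) ∈ T) ∧
      (∀ (x : List Bool) (ι m : ℕ), schemeEnc (x, ι, m) ∈ T → uniformProb m (accEvent M x ι) < 2 / 3) := by
  obtain ⟨T, hTP, hyes, hno⟩ := hBPP (accThreshold_mem_PromiseBPP' hM)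
  refine ⟨T, hTP, fun x ι m h => hyes ((schemeEnc_mem_accThreshold_yes_iff M x ι m).2 h),
    fun x ι m h => ?_⟩
  by_contra hlt
  exact hno ((schemeEnc_mem_accThreshold_no_iff M x ι m).2 (not_lt.1 hlt)) h

end Literature.Computability.MetaComplexity
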